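import Literature.NumberTheory.EllipticCurves.AnticyclotomicSignedCompactSelmer
import Literature.NumberTheory.GaloisRepresentations.AbsGaloisGroupCompact
import HarnessLib

/-!
# The LOCAL signed (plus/minus) conditions above `p` as Iwasawa modules: Hatley–Lei–Vigni's
# `ℋ^±_v ⊂ H¹(K_{∞,v}, E[p^∞])` and its Pontryagin dual `(ℋ^±_v)^∨` (free of rank one over `Λ`,
# Prop. 3.2 (a), odd `p`), and the compact local signed module `H¹_±(K_v, 𝐓^ac) = lim← ℋ^±_{n,v}[p^m]`
# (Castella–Wan Def. 4.6 / §6.1), over the LOCALISED `ℤ_p`-extension `K_{∞,w}/K_v`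

Topic `Literature/NumberTheory/EllipticCurves`; namespace `Literature.NumberTheory.EllipticCurves.AcSigned`
(continuing `AnticyclotomicSignedSelmer.lean` — discrete carriers, `signedKummerInfty`, `Setting` —
and `AnticyclotomicSignedCompactSelmer.lean` — `toInfty`, `lambdaAdic`, `moduleOfGen` —), plus four
general lemmas in `Literature.NumberTheory.EllipticCurves.ZpExtension`. Cell `pub/bsd-wall` (rung
W-ALL of the BSD summit), literature-typer seat `bsd-wall-utd-ty1` (generation 3; director-bsd g12
(142)(e)), `--supports` stmt-BirchSwinnertonDyer-23594 = crux `TwinSplitIMCAtThreeGoodSSApZero` of the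
route `UniversalToricDescent`, whose `⊇`/Howard half is a PORT to `p = 3`, `a_3 = 0` of Castella–Wan's
Thm. A.5 + Thm. 6.8; the previous generations recorded as the honest gap: "the local `Λ^ac`-adic
carriers `H¹_±(K_v, 𝐓^ac)` themselves … Hatley–Lei–Vigni Prop. 3.2 (a)/(b) (`(ℋ^±_w)^∨ ≅ Λ`): need a
`Λ`-structure on the dual of the LOCAL group". HONEST FRAMING: DEFINITIONS with bodies (the local
objects, obtained by running the sibling files' GENERAL-FIELD constructions over the LOCAL base
field `E = K_v` with the LOCALISED `ℤ_p`-extension), PROVED structural lemmas, two CONSTRUCTED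
`ℤ_p⟦T⟧`-module structures (`def`s, no instance, no hypothesis structure), and THREE statement-only
named facts (`def … : Prop`, D-0014, hypotheses as printed, specialised as documented; nothing
asserted, no `_holds`) — two of them (Hatley–Lei–Vigni Prop. 3.2 (a) and the display in the proof of
Lemma 3.8, odd `p`) USABLE AT `p = 3`, the third (Castella–Wan §6.1, `p > 3`) verbatim. Typed ≠ proved ≠ endorsed; BSD is not advanced by
this file; the crux stays open.

## The design (one idea)

Every construction of the two sibling carrier files is written for an ARBITRARY base field `K`, a
`ℤ_p`-extension `κ : Γ_K ↠ ℤ_p` (`ZpExtension K p`), a Weierstrass curve over `K` and, for the local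
conditions, a `K`-embedding `ι : K̄ → K̄_E` of algebraic closures. The completion `E = K_v` at a
prime `v ∣ p` with EXACTLY ONE prime of `K_∞` above it (e.g. `v` totally ramified in `K_∞/K`, the
case of the `Setting`: `p ∤ h_K`) carries its own `ℤ_p`-extension `K_{∞,w}/K_v`: the composite
`κ_v = κ ∘ res : Γ_{K_v} → Γ_K → ℤ_p` is SURJECTIVE (its image is the decomposition group of `w` in
`Γ ≃ ℤ_p`). So:
1. (Part 0) **`ZpExtension.localize κ ι h : ZpExtension E p`** (`h` = surjectivity of `κ ∘ res_ι`),
   with `kerSubgroup`/`layerSubgroup` = the sibling files' `localSubgroupOfEmb`/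
   `localLayerSubgroupOfEmb` (by `rfl`): its layers are `Gal(K̄_v/K_n·K_v) = Gal(K̄_v/K_{n,w})`.
2. (Part 1/2) the three general arguments (P), (A1), (A2) of `GreenbergSelmerDualDataExistsProofs` /
   `IwasawaSelmerDualProofs` — `p`-power torsion of `H¹(ker κ, A)`, continuity of the `Γ`-action,
   "`conj_{γ^{p^a}}` fixes every class" — re-run INSIDE the proof of `isLocNil_conjLocal_sub_one` for
   the base field `E` (the tree's lemmas carry a `[NumberField K]` section variable; the local
   field `K_v` is not a number field), using the tree's `absoluteGaloisGroup_compactSpace`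
   (compactness of `Γ_E` for EVERY field) and `isOpen_stabilizer_geomPrimaryTorsion` (Part 1).
   Same proofs (Greenberg 1999 §1), no new idea.
3. (Part 2) over a LOCAL base (`E` any field, `W_E` a curve over `E`, `κ_E : ZpExtension E p`):
   **`localSignedKummer W_E p κ_E ε ≤ H¹(Gal(Ē/E_∞), W_E[p^∞])`** = the Kummer classes coming from
   `E^ε(E_∞) ⊗ ℚ_p/ℤ_p`, `E^ε(E_∞) = ⋃_n E^ε(E_n)` (the sibling `signedKummerInfty` at the identity
   embedding `Ē → Ē`, intersected over its `Γ_E`-conjugates so that `Γ_E`-stability is by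
   construction — flag `local-conj-intersection`) — for `E = K_v`, `κ_E = κ_v` this IS
   Hatley–Lei–Vigni's `ℋ^±_v ⊂ H¹(K_{∞,v}, A)` ((3.1) + Remark 3.1); its Pontryagin dual
   **`XLoc = (ℋ^ε)^∨`** with the CONSTRUCTED `Λ = ℤ_p⟦T⟧`-structure **`XLoc.moduleOfGen hγ`**
   (`T ↦ conj_{γ_E} − 1` for a topological generator `γ_E ∈ Γ_E` of `κ_E`; `IwasawaDual.IsLocNil.module`
   on the PROVED local nilpotence `isLocNil_conjLocal_sub_one`), certified by `XLoc.X_smul_apply`,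
   `XLoc.C_smul_apply`; the predicate `XLoc.IsFreeRankOne` (the shape of Prop. 3.2 (a)); the
   finite-level conditions **`localCondTorsion … ε n m = ℋ^ε_{n}[p^m] ≤ H¹(E_n, W_E[p^m])`** (pullback
   along the sibling `toInfty`; Hatley–Lei–Vigni Def. 3.4 at `v ∣ p`), PROVED `Γ_E`-stable; the compact
   modules **`localSignedLambdaAdic … γ_E ε = H¹_ε(E, 𝐓) := lim←_{n,m} ℋ^ε_n[p^m]`** (norm-compatible,
   `p_*`-compatible families: the sibling `lambdaAdic`) and **`localLambdaAdic … γ_E = H¹(E, 𝐓) =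
   lim←_{n,m} H¹(E_n, W_E[p^m])`** with their `moduleOfGen`, `localSignedLambdaAdic_le_localLambdaAdic`,
   and the predicates `localSignedLambdaAdic.IsFreeRankOne`, `localLambdaAdic.IsFreeOfRank r`.
4. (Part 3) at a prime `v` of a number field: `IsNonsplitIn κ v` (surjectivity of `κ ∘ res_v` for the
   tree's chosen embedding `closureEmb K_v`), the hypothesis under which `κ.localize` is available.
5. (Part 4) three NAMED FACTS: `hatleyLeiVigni2022_prop32a_localSignedDual_free_rank_one` (Prop. 3.2
   (a): `(ℋ^±_v)^∨` is free of rank one over `Λ`; odd `p`, so USABLE AT `p = 3`),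
   `hatleyLeiVigni2022_lemma38_card_localCondTorsion` (proof of Lemma 3.8 + Remark 3.1: `#ℋ^±_{n,v}[p^m]
   = p^{m·p^n}`; odd `p`, USABLE AT `p = 3`; a finite, checkable statement) and
   `castellaWan2024_sec61_localSignedLambdaAdic_free_rank_one` (§6.1 with Prop. 3.11 / Def. 4.6: the
   compact `H¹_±(K_v, 𝐓^ac_{v₁})` is free of rank one over `ℤ_p⟦Γ^ac_{v₁}⟧`; `p > 3` VERBATIM).

## Sources, VERBATIM (texts read by this seat 2026-08-28; locators)

* [HatleyLeiVigni2022] J. Hatley, A. Lei, S. Vigni, *`Λ`-submodules of finite index of anticyclotomic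
  plus and minus Selmer groups of elliptic curves*, Manuscripta Math. 167 (2022) 589–612, author TeX
  `paper:arxiv-2003.10301`. §1.1: "`p` will denote an odd prime number. Let `E/ℚ` be an elliptic
  curve of conductor `N` with good supersingular reduction at `p` and `a_p(E) = 0` … `K` an imaginary
  quadratic field such that all the primes dividing `pN` split in `K` … We assume that the two primes
  of `K` above `p` are totally ramified in `K_∞`; this … holds if `p` does not divide the class number
  of `K`". §2.1: "`K_∞ := ∪ K_n`, `G_n := Gal(K_n/K) ≃ ℤ/p^n`", §2.2: "we fix a topological generator
  `γ_∞` of `G_∞` … `Λ := lim← ℤ_p[G_n] = ℤ_p⟦G_∞⟧` … `γ_∞ ↦ 1 + X`". §3.1: "For `v ∈ {𝔭, 𝔭^c}`, set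
  `Ê^±(K_{n,v}) := {P ∈ Ê(𝔪_{K_{n,v}}) | Tr_{n/m+1}(P) ∈ Ê(𝔪_{K_{m,v}}) for all m ∈ S^±_n}`" (`S^+_n` =
  even, `S^-_n` = odd `m` in `[0, n]`); **(3.1)** "`ℋ^±_v := ⋃_{n ≥ 0} Ê^±(K_{n,v}) ⊗ ℚ_p/ℤ_p`", "`ℋ^±_{n,v}
  := (ℋ^±_v)^{Gal(K_{∞,v}/K_{n,v})}`"; **Remark 3.1** "Using the Kummer map and the fact … that the
  natural maps `H¹(K_n, E[p^∞]) → H¹(K_{∞,v}, E[p^∞])^{𝒢_{∞/n}}` and `H¹(K_{n,v}, E[p^m]) → H¹(K_{n,v},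
  E[p^∞])[p^m]` are isomorphisms, we may identify `ℋ^±_v` as a `Λ`-submodule of `H¹(K_{∞,v}, A) :=
  lim→_n H¹(K_{n,v}, A)`. In turn, we may identify `ℋ^±_{n,v}` and `ℋ^±_{n,v}[p^m]` as submodules of
  `H¹(K_{n,v}, A)` and `H¹(K_{n,v}, A_m)`"; "let `(ℋ^±_v)^∨` be the Pontryagin dual of `ℋ^±_v`";
  **Prop. 3.2** "(a) The `Λ`-module `(ℋ^±_v)^∨` is free of rank one. (b) Let `m, n ∈ ℕ`. Under the
  local Tate pairing `H¹(K_{n,v}, A_m) × H¹(K_{n,v}, A_m) → ℤ/p^m ℤ`, the exact annihilator of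
  `ℋ^±_{n,v}[p^m]` is `ℋ^±_{n,v}[p^m]`. *Proof.* Part (a) is [Kim07, Prop. …] when the sign is `−`. This
  has been subsequently generalized to the `+` case in [Kim14, …], as our ground field is `ℚ_p`.
  Part (b) then follows from the proof of [Kim07, …]"; **Def. 3.4** (the condition `H¹(K_{n,v}, A_m)/
  ℋ^±_{n,v}[p^m]` at `v ∣ p`); proof of **Lemma 3.8**: "`H⁰(K_{n',v}, A_m) = 0` … `res : H¹(K_{n,v}, A_m)
  ≅ H¹(K_{n',v}, A_m)^{𝒢_{n'/n}}` … `ℋ^±_{n,v}[p^m] = ℋ^±_{n',v}[p^m]^{𝒢_{n'/n}}` … Prop. 3.2 (a) tells us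
  that … `ℋ^±_{n,v}[p^m] ≃ ((ℤ/p^m)[G_n])^∨`".
* [CastellaWan2023] F. Castella, X. Wan, Math. Ann. 389 (2024) 2595–2636 = accepted MS
  `paper:url-7157bd4f7b88` (journal p = MS p + 2594). §3 (MS p. 9) "good supersingular reduction at
  an ODD prime `p` with `a_p = 0`"; **Def. 3.6** (MS p. 13) "`H¹_±(k_{m,n}, T)` … the orthogonal
  complement of `E^±(k_{m,n}) ⊗ ℚ_p/ℤ_p`"; **Lemma 3.9** (MS p. 15) "`H¹_±(k_{m,n}, T)` is a free
  `Λ_{m,n}`-module of rank one [DI08, Lem. 3.9]"; **Prop. 3.11** + MS p. 16 "`b^ε` generates the free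
  `Λ`-module `H¹_ε(ℚ_p, 𝐓_𝔭)`"; §4.2 **Def. 4.6** (MS p. 21, `p > 3`): "Let `H¹_±(K_v, 𝐓^ac_{v₁})` be the
  image of `H¹_±(K_v, 𝐓_{v₁}) ≃ H¹_±(ℚ_p, 𝐓_𝔭)` under the map induced by the projection `Γ ↠ Γ^ac`,
  and set `H¹_±(K_v, 𝐓^ac) := ⊕_{i=1}^{p^t} γ_i.H¹_±(K_v, 𝐓^ac_{v₁})`" (`v₁, …, v_{p^t}` the primes of
  `K^ac_∞` above `v`); §6.1 (MS p. 25, `p > 3`): "for every prime `v` of `K` above `p` we have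
  `H¹_±(K_v, 𝐓_{v₁}) ≃ H¹_±(ℚ_p, 𝐓_𝔭)`, which is generated as `ℤ_p⟦Γ_{v₁}⟧`-module by the element `b^±`
  … `a^±_m := Cor_{k_{m+a,m}/L_{m,v₁}}(b̃^±_{m+a,m}) ∈ H¹_±(L_{m,v₁}, T)` … we obtain a system `a^± =
  {a^±_m}_m ∈ lim←_m H¹_±(K^ac_{m,v₁}, T) ≃ H¹_±(K_v, 𝐓^ac_{v₁})` which by Proposition 3.11 generates
  `H¹_±(K_v, 𝐓^ac_{v₁})` as a free rank one `ℤ_p⟦Γ^ac_{v₁}⟧`-module"; proof of Thm. 6.8 (MS p. 30)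
  "Since `H¹_±(K_𝔭, 𝐓^ac) ≃ Λ^ac` (see Proposition 3.8)".
* [BDKim2013] B. D. Kim, J. Aust. Math. Soc. 95 (2013), §2 Def. 2.1 and "Let `E^±(k_∞) = ∪E^±(k_n)`",
  **Prop. 2.2/2.3** (`(E^−(k_∞) ⊗ ℚ_p/ℤ_p)^∨ ≅ Λ^d`, `(E^+(k_∞) ⊗ ℚ_p/ℤ_p)^∨ ≅ Λ` for `k = ℚ_p`), Def. 3.3
  "`H^±_w = E^±(F_{∞,w}) ⊗ ℚ_p/ℤ_p ⊂ H¹(F_{∞,w}, A)`" — the sources of Hatley–Lei–Vigni's (3.1).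
* [GreenbergLNM1716] R. Greenberg, LNM 1716 (1999) §1 (PDF p. 60): `H¹(F_∞, E[p^∞])` is a torsion
  `ℤ_p`-module on which `Γ` acts continuously ("every element … is killed by `Tⁿ` for some `n`"), the
  source of (P), (A1), (A2) (as in the tree's `GreenbergSelmerDualDataExistsProofs`).

## READING FLAGS (informational — where the transcription is a reading, not a printed sentence)

* `localize-nonsplit`: `K_{∞,w}/K_v` is presented by `κ_v = κ ∘ res_v : Γ_{K_v} → ℤ_p`, a
  `ℤ_p`-extension iff SURJECTIVE iff `w` is the only prime of `K_∞` above `v` (`IsNonsplitIn κ v`);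
  in the `Setting` (`p ∤ h_K` ⇒ the primes above `p` totally ramified, Hatley–Lei–Vigni §1.1) this
  holds, but it is carried as an explicit hypothesis of the facts (it is needed to FORM `κ_v`), not
  derived here. Then the layer `n` of `κ_v` is `Gal(K̄_v/K_n·K_v) = Gal(K̄_v/K_{n,w})`
  (`layerSubgroup_localize`, `rfl`) and a topological generator `γ_v ∈ Γ_{K_v}` of `κ_v` restricts to
  one of `κ` — the local image of Hatley–Lei–Vigni's `γ_∞` (their `Λ`-structure on local groups is
  through `Gal(K_{∞,v}/K_v) ≃ G_∞`).
* `local-conj-intersection`: `localSignedKummer` is the intersection over `σ ∈ Γ_E` of the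
  `conj_σ`-translates of the Kummer condition `signedKummerInfty W_E p κ_E id ε`; in print `ℋ^±_v` is a
  `Λ`-submodule (Remark 3.1), i.e. `Γ_{K_v}`-stable (the groups `E^±(K_{n,v})` are Galois-stable and
  the Kummer map is equivariant), so the intersection IS `ℋ^±_v` — an identification carried by the
  consumer; the intersection makes `Γ_E`-stability (needed for the `Λ`-structure) definitional.
* `HLV-formal-vs-full-points` (inherited from `AnticyclotomicSignedSelmer.lean`): the tree's
  `signedLocalPointsOfEmb` imposes the trace conditions on `E(K_{n,w})`, print on the formal group
  `Ê(𝔪_{K_{n,v}})`; after `⊗ ℚ_p/ℤ_p` (indeed after `⊗ ℤ_p`) the groups agree, `Ẽ(𝔽_p)` having order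
  `p + 1` prime to `p` at every (totally ramified) layer.
* `dual-convention`: `(T·x)(s) = x(conj_{γ} s) − x(s)` (`XLoc.X_smul_apply`, as `AcSigned.X`); a source
  writing `(λ·x)(s) = x(λ^ι s)` differs by the involution `ι : γ ↦ γ⁻¹`, under which "free of rank
  one" is invariant.
* `CW24-local-condition` (inherited): Castella–Wan DEFINE `H¹_±(K_v, 𝐓^ac_{v₁})` as the `Γ ↠ Γ^ac`-image
  of the two-variable `H¹_±(ℚ_p, 𝐓_𝔭)` (Def. 4.6) and USE the presentation `lim←_m H¹_±(K^ac_{m,v₁}, T)`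
  (§6.1); `localSignedLambdaAdic` is `lim←_{n,m}` of Hatley–Lei–Vigni's `ℋ^±_{n,v}[p^m]`, which is the
  finite-level compact condition by Prop. 3.2 (b) (its own exact annihilator) — the identification is
  carried by the consumer (the sibling file's docstring gives the argument), not formalised.
* `Shapiro`/`lim-m` (inherited): `H¹(K_v, 𝐓^ac) = lim←_n H¹(K_{n,w}, T)` (one prime above `v`),
  `H¹(K_{n,w}, T) = lim←_m H¹(K_{n,w}, E[p^m])`.
* `local-curve`: at a prime `v` of `K` the local curve is `(W⁄K).baseChange K_v` over `E = K_v`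
  (geometric points over `K̄_v`); its relation to the sibling files' `localPoints (W⁄K) K_v` (points of
  `W⁄K` over `K̄_v`, where `condAbove … (sgn ε)` is cut out) is the base-change identification
  `localPointsEquivBaseChange` of the tree — the LOCALISATION MAP `loc_v : Sel^{𝓛}(K, 𝐓^ac) →
  H¹(K_v, 𝐓^ac)` through it is NOT typed in this file (TODO(loc): `resH1Hom` along `res_v` with the
  coefficient transport `E[p^m](K̄) → E[p^m](K̄_v)`).

## NOT in this file (and why)

* Hatley–Lei–Vigni Prop. 3.2 (b) (exact annihilator), Castella–Wan Def. 3.6 / Prop. 3.8 / Def. 3.12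
  (`Col^±`, `Log^±`), Def. 6.1 (`Log^±_v`), Thm. 6.2: they need the local Tate pairing / the Coleman
  maps on the tree's `H¹`'s (not typed). The localisation maps `loc_v` and (6.12)–(6.13) (flag
  `local-curve`). B.-D. Kim 2013 Prop. 2.2/2.3 (the sources of Prop. 3.2 (a); Prop. 2.2 is for
  `[k : ℚ_p] = d`, here `d = 1`) are not typed separately.
* No instance, no notation; the module structures are `def`s (`letI`).
-/

noncomputable section

open scoped Classical

open NumberField IsDedekindDomain Field
open Literature.NumberTheory.EllipticCurves Literature.NumberTheory.GaloisRepresentations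
open Literature.NumberTheory.EllipticCurves.Kobayashi2003
open Literature.NumberTheory.EllipticCurves.IwasawaDual
open WeierstrassCurve (geomTorsion geomPoints geomPrimaryTorsion)

universe u

namespace Literature.NumberTheory.EllipticCurves

/-! ## Part 0. Localising a `ℤ_p`-extension along an embedding of algebraic closures -/

namespace ZpExtension

variable {K : Type u} [Field K] {p : ℕ} [Fact p.Prime] (κ : ZpExtension K p)
  {E : Type u} [Field E] [Algebra K E] (ι : AlgebraicClosure K →ₐ[K] AlgebraicClosure E)

/-- **The localised `ℤ_p`-extension `κ_E = κ ∘ res_ι : Γ_E → Γ_K → ℤ_p`** of a field extension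
`E/K` along a `K`-embedding `ι : K̄ → K̄_E`, under the hypothesis `h` that the composite is still
SURJECTIVE (for `E = K_v`: the decomposition group of the place of `K_∞` singled out by `ι` is all
of `Gal(K_∞/K)`, i.e. there is exactly one prime of `K_∞` above `v`; e.g. `v` totally ramified in
`K_∞/K`). Its tower is `E_n = K_n·E` (`layerSubgroup_localize`). Hatley–Lei–Vigni §1.1/§3.1: the local
tower `K_{n,v}` with `Gal(K_{∞,v}/K_v) ≃ G_∞` when `v` is totally ramified.
[cite: HatleyLeiVigni2022, §1.1 and §3.1] [cite: Iwasawa1973, §1] -/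
def localize (h : Function.Surjective (κ.toContinuousMonoidHom.comp (resGalOfEmb ι))) :
    ZpExtension E p :=
  ⟨κ.toContinuousMonoidHom.comp (resGalOfEmb ι), h⟩

/-- Unfolding `localize`: `κ_E τ = κ (res_ι τ)`. [cite: HatleyLeiVigni2022, §3.1] -/
@[simp]
theorem localize_apply (h : Function.Surjective (κ.toContinuousMonoidHom.comp (resGalOfEmb ι)))
    (τ : absoluteGaloisGroup E) : κ.localize ι h τ = κ (resGalOfEmb ι τ) :=
  rfl

/-- `ker κ_E = res_ι⁻¹(ker κ) = Gal(K̄_E/K_∞·E)` (the sibling files' `localSubgroupOfEmb`).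
[cite: HatleyLeiVigni2022, §3.1] -/
theorem kerSubgroup_localize (h : Function.Surjective (κ.toContinuousMonoidHom.comp (resGalOfEmb ι))) :
    (κ.localize ι h).kerSubgroup = localSubgroupOfEmb κ.kerSubgroup ι :=
  rfl

/-- The layer `n` of `κ_E` is `res_ι⁻¹(Gal(K̄/K_n)) = Gal(K̄_E/K_n·E)`, the tree's
`Kobayashi2003.localLayerSubgroupOfEmb κ ι n` (so the local tower of `κ_E` is `K_{n,w}`).
[cite: HatleyLeiVigni2022, §3.1] -/
theorem layerSubgroup_localize (h : Function.Surjective (κ.toContinuousMonoidHom.comp (resGalOfEmb ι)))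
    (n : ℕ) : (κ.localize ι h).layerSubgroup n = localLayerSubgroupOfEmb κ ι n :=
  rfl

/-- `γ_E` is a topological generator of `κ_E` iff its restriction `res_ι γ_E` is one of `κ`.
[cite: HatleyLeiVigni2022, §2.2] -/
theorem isTopGenerator_localize_iff
    (h : Function.Surjective (κ.toContinuousMonoidHom.comp (resGalOfEmb ι))) (γE : absoluteGaloisGroup E) :
    (κ.localize ι h).IsTopGenerator γE ↔ κ.IsTopGenerator (resGalOfEmb ι γE) :=
  Iff.rfl

end ZpExtension

namespace AcSigned

/-! ## Part 1. Open stabilisers of torsion points over an arbitrary base field -/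

section AnyField

variable {K : Type u} [Field K] {p : ℕ} (W : WeierstrassCurve K)

/-- The stabiliser in `Γ_K` of a `p`-primary torsion point of `W` is open (it is the stabiliser of
the underlying geometric point, `WeierstrassCurve.isOpen_stabilizer_point_holds`), over ANY base
field. [cite: SerreGaloisCohomology1997, II.§1 (discrete Galois modules)] -/
theorem isOpen_stabilizer_geomPrimaryTorsion (m : W.geomPrimaryTorsion p) :
    IsOpen (MulAction.stabilizer (absoluteGaloisGroup K) m : Set (absoluteGaloisGroup K)) := by
  have hm : (MulAction.stabilizer (absoluteGaloisGroup K) m : Set (absoluteGaloisGroup K)) =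
      MulAction.stabilizer (absoluteGaloisGroup K) (m : geomPoints W) := by
    ext τ
    simp only [SetLike.mem_coe, MulAction.mem_stabilizer_iff, Subtype.ext_iff,
      primaryComponent.coe_smul]
  rw [hm]
  exact W.isOpen_stabilizer_point_holds (m : geomPoints W)

end AnyField

/-! ## Part 2. The local signed Kummer module `ℋ^ε`, its dual `(ℋ^ε)^∨`, and the compact local
modules `H¹_ε(E, 𝐓) ⊆ H¹(E, 𝐓)` over a local base -/

section LocalBase

variable {E : Type u} [Field E] (WE : WeierstrassCurve E) (p : ℕ) [Fact p.Prime]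
  (κE : ZpExtension E p)

/-- **`ℋ^ε ⊂ H¹(Gal(Ē/E_∞), W_E[p^∞])`, the local signed Kummer module** over the base `E` (intended:
`E = K_v`, `κ_E = κ_v`, `E_∞ = K_{∞,w}`): the classes which, together with all their
`Γ_E`-conjugates, are Kummer classes of elements of `E^ε(E_∞) ⊗ ℚ_p/ℤ_p`, `E^ε(E_∞) = ⋃_n E^ε(E_n)`
(the sibling `signedKummerInfty W_E p κ_E id ε`, Kobayashi's trace conditions along the layers of
`κ_E`, at the identity embedding `Ē → Ē`; intersected over conjugates, flag `local-conj-intersection`).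
Hatley–Lei–Vigni (3.1): "`ℋ^±_v := ⋃_{n ≥ 0} Ê^±(K_{n,v}) ⊗ ℚ_p/ℤ_p`", Remark 3.1: "we may identify
`ℋ^±_v` as a `Λ`-submodule of `H¹(K_{∞,v}, A)`"; B.-D. Kim 2013 Def. 3.3 "`H^±_w = E^±(F_{∞,w}) ⊗
ℚ_p/ℤ_p ⊂ H¹(F_{∞,w}, A)`". [cite: HatleyLeiVigni2022, (3.1) and Remark 3.1] [cite: BDKim2013, Def. 3.3 (p. 193)] -/
def localSignedKummer (ε : ℤˣ) : AddSubgroup (WE.subgroupH1 p κE.kerSubgroup) :=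
  ⨅ σ : absoluteGaloisGroup E,
    (signedKummerInfty WE p κE (AlgHom.id E (AlgebraicClosure E)) ε).comap
      (conjH1 κE.kerSubgroup (WE.geomPrimaryTorsion p) σ)

/-- Membership in `ℋ^ε`: every conjugate lies in the signed Kummer condition at the identity
embedding. [cite: HatleyLeiVigni2022, (3.1) and Remark 3.1] -/
theorem mem_localSignedKummer_iff (ε : ℤˣ) (c : WE.subgroupH1 p κE.kerSubgroup) :
    c ∈ localSignedKummer WE p κE ε ↔ ∀ σ : absoluteGaloisGroup E,
      conjH1 κE.kerSubgroup (WE.geomPrimaryTorsion p) σ c ∈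
        signedKummerInfty WE p κE (AlgHom.id E (AlgebraicClosure E)) ε := by
  simp only [localSignedKummer, AddSubgroup.mem_iInf, AddSubgroup.mem_comap]

/-- `ℋ^ε` is contained in the signed Kummer condition at the identity embedding (the conjugate by
`σ = 1`). [cite: HatleyLeiVigni2022, (3.1)] -/
theorem localSignedKummer_le (ε : ℤˣ) :
    localSignedKummer WE p κE ε ≤ signedKummerInfty WE p κE (AlgHom.id E (AlgebraicClosure E)) ε := by
  intro c hc
  have h := (mem_localSignedKummer_iff WE p κE ε c).1 hc 1
  rwa [conjH1_one_holds κE.kerSubgroup (WE.geomPrimaryTorsion p), AddMonoidHom.id_apply] at h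

/-- **`ℋ^ε` is `Γ_E`-stable** (the family of conjugates is permuted; `conjH1_mul_holds`) — the
`Λ`-submodule structure of Hatley–Lei–Vigni's Remark 3.1. [cite: HatleyLeiVigni2022, Remark 3.1] -/
theorem conjH1_mem_localSignedKummer (ε : ℤˣ) (τ : absoluteGaloisGroup E)
    {c : WE.subgroupH1 p κE.kerSubgroup} (hc : c ∈ localSignedKummer WE p κE ε) :
    conjH1 κE.kerSubgroup (WE.geomPrimaryTorsion p) τ c ∈ localSignedKummer WE p κE ε := by
  rw [mem_localSignedKummer_iff] at hc ⊢
  intro σ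
  have e : conjH1 κE.kerSubgroup (WE.geomPrimaryTorsion p) σ
        (conjH1 κE.kerSubgroup (WE.geomPrimaryTorsion p) τ c) =
      conjH1 κE.kerSubgroup (WE.geomPrimaryTorsion p) (σ * τ) c := by
    rw [conjH1_mul_holds κE.kerSubgroup (WE.geomPrimaryTorsion p) σ τ]; rfl
  rw [e]
  exact hc (σ * τ)

/-- `conj_σ` restricted to an endomorphism of `ℋ^ε` (`conjH1_mem_localSignedKummer`).
[cite: HatleyLeiVigni2022, Remark 3.1 (the `Λ`-action)] -/
def conjLocal (ε : ℤˣ) (σ : absoluteGaloisGroup E) : AddMonoid.End (localSignedKummer WE p κE ε) :=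
  ((conjH1 κE.kerSubgroup (WE.geomPrimaryTorsion p) σ).restrict (localSignedKummer WE p κE ε)).codRestrict
    (localSignedKummer WE p κE ε) fun s ↦ conjH1_mem_localSignedKummer WE p κE ε σ s.2

/-- Unfolding `conjLocal`: on classes it is `conj_σ` (definitional).
[cite: HatleyLeiVigni2022, Remark 3.1 (the `Λ`-action)] -/
@[simp]
theorem coe_conjLocal_apply (ε : ℤˣ) (σ : absoluteGaloisGroup E) (s : localSignedKummer WE p κE ε) :
    ((conjLocal WE p κE ε σ s : localSignedKummer WE p κE ε) : WE.subgroupH1 p κE.kerSubgroup) =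
      conjH1 κE.kerSubgroup (WE.geomPrimaryTorsion p) σ s :=
  rfl

/-- Powers of the restriction are restrictions of `conj_{σ^m}` (conjugation is an action).
[cite: HatleyLeiVigni2022, Remark 3.1 (the `Λ`-action)] -/
theorem coe_conjLocal_pow_apply (ε : ℤˣ) (σ : absoluteGaloisGroup E) (m : ℕ)
    (s : localSignedKummer WE p κE ε) :
    ((((conjLocal WE p κE ε σ) ^ m) s : localSignedKummer WE p κE ε) : WE.subgroupH1 p κE.kerSubgroup) =
      conjH1 κE.kerSubgroup (WE.geomPrimaryTorsion p) (σ ^ m) s := by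
  induction m generalizing s with
  | zero =>
    rw [pow_zero, pow_zero, AddMonoid.End.one_apply,
      conjH1_one_holds κE.kerSubgroup (WE.geomPrimaryTorsion p), AddMonoidHom.id_apply]
  | succ m ih =>
    rw [pow_succ, AddMonoid.End.coe_mul, Function.comp_apply, ih, coe_conjLocal_apply, pow_succ,
      conjH1_mul_holds κE.kerSubgroup (WE.geomPrimaryTorsion p), AddMonoidHom.comp_apply]

/-- **`ℋ^ε` is `p`-primary and `T = γ_E − 1` is locally nilpotent on it** for a topological generator
`γ_E` of `κ_E` ((P) and (A2) over the base `E`, `IwasawaDual.pow_mul_prime_pow_apply_eq_zero`):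
this is what makes `(ℋ^ε)^∨` a `Λ`-module ("tacitly identify `Λ` with `ℤ_p⟦X⟧` … `γ_∞ ↦ 1 + X`",
Hatley–Lei–Vigni §2.2). [cite: HatleyLeiVigni2022, §2.2 and Remark 3.1] [cite: GreenbergLNM1716, §1 (after Conj. 1.3)] -/
theorem isLocNil_conjLocal_sub_one (ε : ℤˣ) {γE : absoluteGaloisGroup E} (hγ : κE.IsTopGenerator γE) :
    IwasawaDual.IsLocNil p (conjLocal WE p κE ε γE - 1) := by
  haveI : CompactSpace (absoluteGaloisGroup E) := absoluteGaloisGroup_compactSpace E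
  haveI : CompactSpace κE.kerSubgroup :=
    isCompact_iff_compactSpace.mp κE.isClosed_kerSubgroup.isCompact
  -- (P): every class of `H¹(Gal(Ē/E_∞), W_E[p^∞])` is killed by a power of `p` (Greenberg 1999 §1;
  -- the tree's `GreenbergSelmer.exists_pow_smul_subgroupH1_eq_zero`, whose copy carries a
  -- number-field section variable, re-run over the base `E`).
  have hP : ∀ c : WE.subgroupH1 p κE.kerSubgroup, ∃ k : ℕ, p ^ k • c = 0 := fun c ↦ by
    obtain ⟨φ, rfl⟩ := oneCocycleClass_surjective _ c
    exact IwasawaDual.exists_pow_smul_oneCocycleClass_eq_zero φ fun σ ↦ by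
      obtain ⟨k, hk⟩ := (φ.1 σ).2
      exact ⟨k, Subtype.ext (by rw [AddSubgroupClass.coe_nsmul]; exact hk)⟩
  -- (A1) + (A2): every class is fixed by `conj_{γ_E^{p^a}}` for some `a` (Greenberg 1999 §1; the
  -- tree's `GreenbergSelmer.exists_openNormalSubgroup_conjH1_eq` / `exists_conjH1_pow_prime_pow_eq`
  -- re-run over the base `E`).
  have hA : ∀ c : WE.subgroupH1 p κE.kerSubgroup,
      ∃ a : ℕ, conjH1 κE.kerSubgroup (WE.geomPrimaryTorsion p) (γE ^ p ^ a) c = c := by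
    intro c
    have hA1 : ∃ Nrm : OpenNormalSubgroup (absoluteGaloisGroup E),
        ∀ τ ∈ Nrm, conjH1 κE.kerSubgroup (WE.geomPrimaryTorsion p) τ c = c := by
      obtain ⟨φ, rfl⟩ := oneCocycleClass_surjective _ c
      have hfin : (Set.range φ.1).Finite := (isCompact_range φ.1.continuous).finite_of_discrete
      set Ufix : Set (absoluteGaloisGroup E) :=
        {τ | ∀ m ∈ Set.range φ.1, τ • m = m} with hUfix_def
      have hUfix : IsOpen Ufix := by
        have e : Ufix = ⋂ m ∈ Set.range φ.1,
            (MulAction.stabilizer (absoluteGaloisGroup E) m : Set (absoluteGaloisGroup E)) := by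
          ext τ
          simp only [hUfix_def, Set.mem_setOf_eq, Set.mem_iInter, SetLike.mem_coe,
            MulAction.mem_stabilizer_iff]
        rw [e]
        exact hfin.isOpen_biInter fun m _ ↦ isOpen_stabilizer_geomPrimaryTorsion WE m
      have hz : IsOpen {h : κE.kerSubgroup | φ.1 h = 0} :=
        (isOpen_discrete ({0} : Set (WE.geomPrimaryTorsion p))).preimage φ.1.continuous
      obtain ⟨U0, hU0, hU0eq⟩ := isOpen_induced_iff.mp hz
      have h1fix : (1 : absoluteGaloisGroup E) ∈ Ufix := fun m _ ↦ one_smul _ m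
      have h1U0 : (1 : absoluteGaloisGroup E) ∈ U0 := by
        have : (1 : κE.kerSubgroup) ∈ Subtype.val ⁻¹' U0 := by
          rw [hU0eq]
          exact contOneCocycles.apply_one φ
        exact this
      obtain ⟨Nrm, hNrm⟩ := ProfiniteGrp.exist_openNormalSubgroup_sub_open_nhds_of_one
        (hUfix.inter hU0) ⟨h1fix, h1U0⟩
      refine ⟨Nrm, fun τ hτ ↦ IwasawaDual.conjH1_oneCocycleClass_eq φ (fun h ↦ ?_) (fun h n hn ↦ ?_)⟩
      · exact (hNrm hτ).1 _ ⟨h, rfl⟩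
      · have hnN : (n : absoluteGaloisGroup E) ∈ Nrm := by
          rw [hn]
          have h1 : (h : absoluteGaloisGroup E)⁻¹ * τ⁻¹ * (h : absoluteGaloisGroup E)⁻¹⁻¹ ∈
              Nrm.toSubgroup :=
            Subgroup.Normal.conj_mem inferInstance _ (Nrm.toSubgroup.inv_mem hτ) _
          rw [inv_inv] at h1
          exact Nrm.toSubgroup.mul_mem h1 hτ
        have hn0 : n ∈ Subtype.val ⁻¹' U0 := (hNrm hnN).2
        rw [hU0eq] at hn0
        exact hn0
    obtain ⟨Nrm, hNrm⟩ := hA1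
    haveI : Finite (absoluteGaloisGroup E ⧸ Nrm.toSubgroup) :=
      Subgroup.quotient_finite_of_isOpen _ Nrm.isOpen
    have hd : Nrm.toSubgroup.index ≠ 0 := Subgroup.index_ne_zero_of_finite
    obtain ⟨a, e, he, hde⟩ := Nat.exists_eq_pow_mul_and_not_dvd hd p (Fact.out : p.Prime).ne_one
    obtain ⟨u, hu⟩ := IwasawaDual.isUnit_natCast_padicInt (p := p) he
    obtain ⟨g₀, hg₀⟩ := κE.surjective (Multiplicative.ofAdd ((u⁻¹ : ℤ_[p]ˣ) : ℤ_[p]))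
    have hg₀' : κE g₀ = Multiplicative.ofAdd ((u⁻¹ : ℤ_[p]ˣ) : ℤ_[p]) := hg₀
    have hτN : g₀ ^ Nrm.toSubgroup.index ∈ Nrm := Nrm.toSubgroup.pow_index_mem g₀
    have hκτ : (κE (g₀ ^ Nrm.toSubgroup.index)).toAdd = (p : ℤ_[p]) ^ a := by
      rw [map_pow, hg₀', ← ofAdd_nsmul, toAdd_ofAdd, nsmul_eq_mul, hde, Nat.cast_mul, Nat.cast_pow,
        ← hu, mul_assoc, Units.mul_inv, mul_one]
    have hκγ : (κE (γE ^ p ^ a)).toAdd = (p : ℤ_[p]) ^ a := by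
      rw [map_pow, show κE γE = Multiplicative.ofAdd 1 from hγ, ← ofAdd_nsmul, toAdd_ofAdd,
        nsmul_eq_mul, mul_one, Nat.cast_pow]
    have hh₀ : (g₀ ^ Nrm.toSubgroup.index)⁻¹ * γE ^ p ^ a ∈ κE.kerSubgroup := by
      rw [ZpExtension.mem_kerSubgroup, map_mul, map_inv]
      apply Multiplicative.toAdd.injective
      rw [toAdd_mul, toAdd_inv, hκτ, hκγ, toAdd_one, neg_add_cancel]
    refine ⟨a, ?_⟩
    conv_lhs => rw [← mul_inv_cancel_left (g₀ ^ Nrm.toSubgroup.index) (γE ^ p ^ a)]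
    rw [conjH1_mul_holds κE.kerSubgroup (WE.geomPrimaryTorsion p), AddMonoidHom.comp_apply,
      conjH1_of_mem_holds κE.kerSubgroup (WE.geomPrimaryTorsion p) hh₀, AddMonoidHom.id_apply]
    exact hNrm _ hτN
  have htor : ∀ s : localSignedKummer WE p κE ε, ∃ k : ℕ, p ^ k • s = 0 := fun s ↦ by
    obtain ⟨k, hk⟩ := hP (s : WE.subgroupH1 p κE.kerSubgroup)
    exact ⟨k, Subtype.ext (by rw [AddSubgroupClass.coe_nsmul]; exact hk)⟩
  refine ⟨htor, fun s ↦ ?_⟩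
  obtain ⟨a, ha⟩ := hA (s : WE.subgroupH1 p κE.kerSubgroup)
  obtain ⟨k, hk⟩ := htor s
  have hφ : ((conjLocal WE p κE ε γE) ^ p ^ a) s = s :=
    Subtype.ext (by rw [coe_conjLocal_pow_apply]; exact ha)
  exact ⟨k * p ^ a, IwasawaDual.pow_mul_prime_pow_apply_eq_zero (Fact.out : p.Prime) _ a hφ hk⟩

/-- **`(ℋ^ε)^∨ := Hom(ℋ^ε, ℚ/ℤ)`**, the Pontryagin dual of the local signed Kummer module (`ℚ/ℤ =
AddCircle (1 : ℚ) ⊇ ℚ_p/ℤ_p`, as `AcSigned.X`). Hatley–Lei–Vigni: "let `(ℋ^±_v)^∨` be the Pontryagin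
dual of `ℋ^±_v`" (`M^∨ := Hom^cont_{ℤ_p}(M, ℚ_p/ℤ_p)`, §1). An `abbrev` (a bare abelian group); its
`Λ`-module structure is the DEFINITION `XLoc.moduleOfGen` (no instance).
[cite: HatleyLeiVigni2022, §3.1 (before Prop. 3.2)] -/
abbrev XLoc (ε : ℤˣ) : Type u :=
  localSignedKummer WE p κE ε →+ AddCircle (1 : ℚ)

/-- **The `Λ = ℤ_p⟦T⟧`-module structure of `(ℋ^ε)^∨`** attached to a topological generator `γ_E` of
`κ_E`: `T` acts as `conj_{γ_E} − 1`, constants through `ℤ_p → ℤ/p^k` (`IwasawaDual.IsLocNil.module`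
for `isLocNil_conjLocal_sub_one`). A `def` to be activated with `letI`; CONSTRUCTED, not assumed.
[cite: HatleyLeiVigni2022, §2.2 ("`γ_∞ ↦ 1 + X`") and Prop. 3.2 (a)] -/
@[reducible]
def XLoc.moduleOfGen (ε : ℤˣ) {γE : absoluteGaloisGroup E} (hγ : κE.IsTopGenerator γE) :
    Module (IwasawaAlgebra p) (XLoc WE p κE ε) :=
  (isLocNil_conjLocal_sub_one WE p κE ε hγ).module

/-- **`T` acts as `γ_E − 1`** on `(ℋ^ε)^∨`: `(T·x)(s) = x(conj_{γ_E} s) − x(s)` (flag `dual-convention`).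
[cite: HatleyLeiVigni2022, §2.2 ("`γ_∞ ↦ 1 + X`")] -/
theorem XLoc.X_smul_apply (ε : ℤˣ) {γE : absoluteGaloisGroup E} (hγ : κE.IsTopGenerator γE)
    (x : XLoc WE p κE ε) (s : localSignedKummer WE p κE ε) :
    (letI := XLoc.moduleOfGen WE p κE ε hγ; ((PowerSeries.X : IwasawaAlgebra p) • x) s) =
      x (conjLocal WE p κE ε γE s) - x s := by
  show (isLocNil_conjLocal_sub_one WE p κE ε hγ).smulFun PowerSeries.X x s = _
  rw [(isLocNil_conjLocal_sub_one WE p κE ε hγ).smulFun_X_apply, IwasawaDual.End_sub_apply,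
    AddMonoid.End.one_apply, map_sub]

/-- **Constants `c ∈ ℤ_p` act through `ℤ_p → ℤ/p^k`** on the value at a `p^k`-torsion class.
[cite: Lang1990, Ch. 5 §1] -/
theorem XLoc.C_smul_apply (ε : ℤˣ) {γE : absoluteGaloisGroup E} (hγ : κE.IsTopGenerator γE)
    (c : ℤ_[p]) (x : XLoc WE p κE ε) {s : localSignedKummer WE p κE ε} {k : ℕ} (hk : p ^ k • s = 0) :
    (letI := XLoc.moduleOfGen WE p κE ε hγ; ((PowerSeries.C c : IwasawaAlgebra p) • x) s) =
      (PadicInt.toZModPow k c).val • x s := by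
  show (isLocNil_conjLocal_sub_one WE p κE ε hγ).smulFun (PowerSeries.C c) x s = _
  exact (isLocNil_conjLocal_sub_one WE p κE ε hγ).smulFun_C_apply c x hk

/-- **"`(ℋ^ε)^∨` is free of rank one over `Λ`"** (`Module.Free ∧ Module.finrank = 1` under
`XLoc.moduleOfGen hγ`) — the shape of Hatley–Lei–Vigni Prop. 3.2 (a) / B.-D. Kim 2013 Prop. 2.3.
A predicate; nothing asserted. [cite: HatleyLeiVigni2022, Prop. 3.2 (a)] [cite: BDKim2013, Prop. 2.3 (p. 192)] -/
def XLoc.IsFreeRankOne (ε : ℤˣ) {γE : absoluteGaloisGroup E} (hγ : κE.IsTopGenerator γE) : Prop :=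
  letI := XLoc.moduleOfGen WE p κE ε hγ
  Module.Free (IwasawaAlgebra p) (XLoc WE p κE ε) ∧ Module.finrank (IwasawaAlgebra p) (XLoc WE p κE ε) = 1

/-- **`ℋ^ε_n[p^m] ≤ H¹(E_n, W_E[p^m])`, the finite-level local signed condition**: the pullback of `ℋ^ε`
along `θ_{n,m} : H¹(E_n, W_E[p^m]) → H¹(E_∞, W_E[p^∞])` (the sibling `toInfty`). Hatley–Lei–Vigni:
"`ℋ^±_{n,v} := (ℋ^±_v)^{Gal(K_{∞,v}/K_{n,v})}`" and Remark 3.1 (identify `ℋ^±_{n,v}[p^m]` inside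
`H¹(K_{n,v}, A_m)` through `H¹(K_{n,v}, A_m) = H¹(K_{∞,v}, A)^{𝒢}[p^m]`); Def. 3.4: the local condition
`H¹(K_{n,v}, A_m)/ℋ^±_{n,v}[p^m]` at `v ∣ p`; by Prop. 3.2 (b) it is ALSO the finite-level condition of
the compact side (Castella–Wan Def. 3.6 "orthogonal complement of `E^±(k) ⊗ ℚ_p/ℤ_p`"; flag
`CW24-local-condition`). [cite: HatleyLeiVigni2022, (3.1), Remark 3.1, Def. 3.4]
[cite: CastellaWan2023, Def. 3.6 (MS p. 13)] -/
def localCondTorsion (ε : ℤˣ) (n m : ℕ) :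
    AddSubgroup (WE.torsionH1Over ((p : ℤ) ^ m) (κE.layerSubgroup n)) :=
  (localSignedKummer WE p κE ε).comap (toInfty WE p κE n m)

/-- Membership in `ℋ^ε_n[p^m]` (unfolding). [cite: HatleyLeiVigni2022, Def. 3.4] -/
theorem mem_localCondTorsion_iff (ε : ℤˣ) (n m : ℕ)
    (c : WE.torsionH1Over ((p : ℤ) ^ m) (κE.layerSubgroup n)) :
    c ∈ localCondTorsion WE p κE ε n m ↔ toInfty WE p κE n m c ∈ localSignedKummer WE p κE ε :=
  Iff.rfl

/-- `ℋ^ε_n[p^m]` is stable under the conjugation action of `Γ_E` (`θ_{n,m}` is equivariant,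
`toInfty_conjH1`). [cite: HatleyLeiVigni2022, Remark 3.1 and Def. 3.4] -/
theorem conjH1_mem_localCondTorsion (ε : ℤˣ) (n m : ℕ) (σ : absoluteGaloisGroup E)
    {c : WE.torsionH1Over ((p : ℤ) ^ m) (κE.layerSubgroup n)} (hc : c ∈ localCondTorsion WE p κE ε n m) :
    conjH1 (κE.layerSubgroup n) (geomTorsion WE ((p : ℤ) ^ m)) σ c ∈ localCondTorsion WE p κE ε n m := by
  rw [mem_localCondTorsion_iff, toInfty_conjH1]
  exact conjH1_mem_localSignedKummer WE p κE ε σ hc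

/-- Restriction `E_n → E_{n'}` (`n ≤ n'`) preserves the finite-level signed condition (it is pulled
back from `E_∞`): the first map of Hatley–Lei–Vigni's Lemma 3.8. [cite: HatleyLeiVigni2022, Lemma 3.8] -/
theorem resOfLe_mem_localCondTorsion (ε : ℤˣ) {n n' : ℕ} (h : n ≤ n') (m : ℕ)
    {c : WE.torsionH1Over ((p : ℤ) ^ m) (κE.layerSubgroup n)} (hc : c ∈ localCondTorsion WE p κE ε n m) :
    resOfLe (geomTorsion WE ((p : ℤ) ^ m)) (κE.layerSubgroup_antitone h) c ∈
      localCondTorsion WE p κE ε n' m := by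
  rw [mem_localCondTorsion_iff, toInfty_resOfLe WE p κE h]
  exact hc

/-- **Signed local control between finite layers is definitional here**: for `n ≤ n'`, a class of
`H¹(E_n, W_E[p^m])` satisfies the level-`n` signed condition iff its restriction to `E_{n'}` satisfies
the level-`n'` one (both are pulled back from `E_∞`, and `θ_{n',m} ∘ res = θ_{n,m}`). In print this is
the injectivity of `H¹(K_{n,v}, A_m)/ℋ^±_{n,v}[p^m] → H¹(K_{n',v}, A_m)/ℋ^±_{n',v}[p^m]`, the first map of
Hatley–Lei–Vigni's Lemma 3.8 (there deduced from `ℋ^±_{n,v}[p^m] = ℋ^±_{n',v}[p^m]^{𝒢_{n'/n}}`); the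
content of their Remark 3.1 / Lemma 3.8 is in the identification of the pullback with
`ℋ^±_{n,v}[p^m]` (flag in the module docstring), not in this equivalence.
[cite: HatleyLeiVigni2022, Lemma 3.8 and Remark 3.1] -/
theorem resOfLe_mem_localCondTorsion_iff (ε : ℤˣ) {n n' : ℕ} (h : n ≤ n') (m : ℕ)
    (c : WE.torsionH1Over ((p : ℤ) ^ m) (κE.layerSubgroup n)) :
    resOfLe (geomTorsion WE ((p : ℤ) ^ m)) (κE.layerSubgroup_antitone h) c ∈
        localCondTorsion WE p κE ε n' m ↔
      c ∈ localCondTorsion WE p κE ε n m := by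
  rw [mem_localCondTorsion_iff, mem_localCondTorsion_iff, toInfty_resOfLe WE p κE h]

variable (γE : absoluteGaloisGroup E)

/-- **`H¹_ε(E, 𝐓) = lim←_{n,m} ℋ^ε_n[p^m]`, the compact local signed module** (intended: `E = K_v`,
`H¹_±(K_v, 𝐓^ac)`): the norm-compatible, `p_*`-compatible families (the sibling `lambdaAdic`, for the
generator `γ_E`) cut out by the finite-level signed conditions. Castella–Wan §6.1: "`a^± = {a^±_m}_m ∈
lim←_m H¹_±(K^ac_{m,v₁}, T) ≃ H¹_±(K_v, 𝐓^ac_{v₁})`", Def. 4.6 (flags `CW24-local-condition`,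
`Shapiro`/`lim-m`); Hatley–Lei–Vigni Def. 3.4 / Prop. 3.2 (b) (finite levels).
[cite: CastellaWan2023, Def. 4.6 and §6.1 (MS pp. 21, 25)] [cite: HatleyLeiVigni2022, Def. 3.4 and Prop. 3.2 (b)] -/
def localSignedLambdaAdic (ε : ℤˣ) :
    AddSubgroup (Π n m : ℕ, WE.torsionH1Over ((p : ℤ) ^ m) (κE.layerSubgroup n)) :=
  lambdaAdic WE p κE γE fun n m ↦ localCondTorsion WE p κE ε n m

/-- **`H¹(E, 𝐓) = lim←_{n,m} H¹(E_n, W_E[p^m])`, the compact local cohomology** (no condition; intended: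
`H¹(K_v, 𝐓^ac) ≃ lim←_n H¹(K_{n,w}, T)` by Shapiro's lemma, one prime above `v`) — the target of
Castella–Wan's `loc_v` and the home of their `H¹_±(K_v, 𝐓^ac) ⊆ H¹(K_v, 𝐓^ac)` (Def. 4.6, (4.7)).
[cite: CastellaWan2023, (3.10), Def. 4.6 and (4.7) (MS pp. 14, 21–22)] -/
def localLambdaAdic : AddSubgroup (Π n m : ℕ, WE.torsionH1Over ((p : ℤ) ^ m) (κE.layerSubgroup n)) :=
  lambdaAdic WE p κE γE fun _ _ ↦ ⊤

/-- `H¹_ε(E, 𝐓) ≤ H¹(E, 𝐓)`. [cite: CastellaWan2023, Def. 4.6 (MS p. 21)] -/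
theorem localSignedLambdaAdic_le_localLambdaAdic (ε : ℤˣ) :
    localSignedLambdaAdic WE p κE γE ε ≤ localLambdaAdic WE p κE γE :=
  lambdaAdic_mono fun _ _ ↦ le_top

variable {WE p κE γE}

/-- Membership in `H¹_ε(E, 𝐓)` (unfolding `lambdaAdic`): levelwise in `ℋ^ε_n[p^m]`, `p_*`-compatible,
norm-compatible. [cite: CastellaWan2023, §6.1 (MS p. 25)] -/
theorem mem_localSignedLambdaAdic_iff {ε : ℤˣ}
    (x : Π n m : ℕ, WE.torsionH1Over ((p : ℤ) ^ m) (κE.layerSubgroup n)) :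
    x ∈ localSignedLambdaAdic WE p κE γE ε ↔ (∀ n m, x n m ∈ localCondTorsion WE p κE ε n m) ∧
      (∀ n m, WE.reduceTorsionH1 p m (κE.layerSubgroup n) (x n (m + 1)) = x n m) ∧
      ∀ n, WE.resPi p (κE.layerSubgroup_antitone (Nat.le_succ n)) (x n) =
        ∑ i ∈ Finset.range p, WE.conjPi p (κE.layerSubgroup (n + 1)) (γE ^ (p ^ n * i)) (x (n + 1)) :=
  mem_lambdaAdic_iff x

variable (WE p κE γE)

/-- **The `Λ`-module structure of `H¹_ε(E, 𝐓)`** for a topological generator `γ_E` of `κ_E` (the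
sibling `lambdaAdic.moduleOfGen` for the `Γ_E`-stable conditions `localCondTorsion`); activate with
`letI`. CONSTRUCTED; no instance. Castella–Wan §6.1: "a free rank one `ℤ_p⟦Γ^ac_{v₁}⟧`-module".
[cite: CastellaWan2023, §6.1 (MS p. 25)] -/
@[reducible]
def localSignedLambdaAdic.moduleOfGen (hγ : κE.IsTopGenerator γE) (ε : ℤˣ) :
    Module (IwasawaAlgebra p) (localSignedLambdaAdic WE p κE γE ε) :=
  lambdaAdic.moduleOfGen hγ fun n m _ hy ↦ conjH1_mem_localCondTorsion WE p κE ε n m γE hy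

/-- **The `Λ`-module structure of `H¹(E, 𝐓)`** for a topological generator `γ_E` of `κ_E`; activate
with `letI`. CONSTRUCTED; no instance. [cite: CastellaWan2023, (3.10) and §4.1 (MS pp. 14, 19)] -/
@[reducible]
def localLambdaAdic.moduleOfGen (hγ : κE.IsTopGenerator γE) :
    Module (IwasawaAlgebra p) (localLambdaAdic WE p κE γE) :=
  lambdaAdic.moduleOfGen hγ fun _ _ _ _ ↦ AddSubgroup.mem_top _

/-- **"`H¹_ε(E, 𝐓)` is free of rank one over `Λ`"** (`Module.Free ∧ Module.finrank = 1` under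
`localSignedLambdaAdic.moduleOfGen`) — the shape of Castella–Wan §6.1 "`a^±` … generates
`H¹_±(K_v, 𝐓^ac_{v₁})` as a free rank one `ℤ_p⟦Γ^ac_{v₁}⟧`-module" and of "`H¹_±(K_𝔭, 𝐓^ac) ≃ Λ^ac`"
(proof of Thm. 6.8). A predicate; nothing asserted. [cite: CastellaWan2023, §6.1 (MS p. 25) and proof of Thm. 6.8 (MS p. 30)] -/
def localSignedLambdaAdic.IsFreeRankOne (hγ : κE.IsTopGenerator γE) (ε : ℤˣ) : Prop :=
  letI := localSignedLambdaAdic.moduleOfGen WE p κE γE hγ ε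
  Module.Free (IwasawaAlgebra p) (localSignedLambdaAdic WE p κE γE ε) ∧
    Module.finrank (IwasawaAlgebra p) (localSignedLambdaAdic WE p κE γE ε) = 1

/-- **"`H¹(E, 𝐓)` is free of rank `r` over `Λ`"** (`Module.Free ∧ Module.finrank = r` under
`localLambdaAdic.moduleOfGen`) — the shape of Castella–Wan Prop. 3.8 "free `Λ`-modules of rank 1,
2, and 1" ([PR94, Prop. 3.2.1]: `H¹(ℚ_p, 𝐓_𝔭)` free of rank `2`). A predicate; nothing asserted.
[cite: CastellaWan2023, Prop. 3.8 (MS p. 15)] -/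
def localLambdaAdic.IsFreeOfRank (hγ : κE.IsTopGenerator γE) (r : ℕ) : Prop :=
  letI := localLambdaAdic.moduleOfGen WE p κE γE hγ
  Module.Free (IwasawaAlgebra p) (localLambdaAdic WE p κE γE) ∧
    Module.finrank (IwasawaAlgebra p) (localLambdaAdic WE p κE γE) = r

end LocalBase

/-! ## Part 3. At a prime `v` of a number field: the non-splitting hypothesis -/

section AtPlace

variable {K : Type u} [Field K] [NumberField K] {p : ℕ} [Fact p.Prime]

/-- **`v` does not split at all in `K_∞/K`** (exactly one prime of `K_∞` above `v`), in the form
needed to localise `κ`: the composite `κ ∘ res_v : Γ_{K_v} → Γ_K → ℤ_p` (for the tree's chosen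
embedding `closureEmb K_v`) is SURJECTIVE — the decomposition group of the chosen prime above `v` is
all of `Gal(K_∞/K)`. It holds when `v` is totally ramified in `K_∞/K` (Hatley–Lei–Vigni §1.1: "the two
primes of `K` above `p` are totally ramified in `K_∞`; this … holds if `p` does not divide the class
number of `K`", the `Setting`'s `p ∤ h_K`) — flag `localize-nonsplit`: carried as a hypothesis, not
derived here. [cite: HatleyLeiVigni2022, §1.1] [cite: IovitaPollack2006, §2 Hypothesis (S) (arXiv:math/0411496 p. 5)] -/
def IsNonsplitIn (κ : ZpExtension K p) (v : HeightOneSpectrum (𝓞 K)) : Prop :=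
  Function.Surjective (κ.toContinuousMonoidHom.comp (resGal (K := K) (v.adicCompletion K)))

/-- Under `IsNonsplitIn κ v`, the localised `ℤ_p`-extension `κ_v` of `K_v` for the chosen embedding
(`ZpExtension.localize` at `closureEmb K_v`; `resGal = resGalOfEmb (closureEmb _)` definitionally).
[cite: HatleyLeiVigni2022, §3.1 (`Gal(K_{∞,v}/K_v)`)] -/
abbrev localizeAt (κ : ZpExtension K p) (v : HeightOneSpectrum (𝓞 K)) (h : IsNonsplitIn κ v) :
    ZpExtension (v.adicCompletion K) p :=
  κ.localize (closureEmb (K := K) (v.adicCompletion K)) h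

/-- The layers of `κ_v` are the tree's local layer subgroups `Gal(K̄_v/K_n·K_v)`
(`Kobayashi2003.localLayerSubgroup`) — so `signedLocalPointsOfEmb κ_v id`/`localLayerPointsOfEmb κ_v id`
run over the local tower `K_{n,w}` of the sibling files. [cite: HatleyLeiVigni2022, §3.1] -/
theorem layerSubgroup_localizeAt (κ : ZpExtension K p) (v : HeightOneSpectrum (𝓞 K))
    (h : IsNonsplitIn κ v) (n : ℕ) :
    (localizeAt κ v h).layerSubgroup n =
      localLayerSubgroupOfEmb κ (closureEmb (K := K) (v.adicCompletion K)) n :=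
  rfl

end AtPlace

/-! ## Part 4. Hatley–Lei–Vigni Prop. 3.2 (a) and Castella–Wan §6.1 (named facts; statements only,
hypotheses as printed, specialised as documented) -/

section Facts

variable (W : WeierstrassCurve ℚ) [W.IsGloballyMinimal] (K : Type) [Field K] [NumberField K]
  (p : ℕ) [Fact p.Prime] (κ : ZpExtension K p) (𝔭 𝔭' : HeightOneSpectrum (𝓞 K))

/-- **Hatley–Lei–Vigni 2022, Prop. 3.2 (a): the Pontryagin dual `(ℋ^±_v)^∨` of the local signed Kummer
module is a FREE `Λ`-module of RANK ONE** (for each prime `v ∈ {𝔭, 𝔭^c}` of `K` above `p`).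
Printed: "Proposition 3.2. (a) The `Λ`-module `(ℋ^±_v)^∨` is free of rank one", `ℋ^±_v := ⋃_{n ≥ 0}
Ê^±(K_{n,v}) ⊗ ℚ_p/ℤ_p` ((3.1)) identified "as a `Λ`-submodule of `H¹(K_{∞,v}, A)`" by the Kummer map
(Remark 3.1), `Λ = ℤ_p⟦G_∞⟧ ≅ ℤ_p⟦X⟧`, `γ_∞ ↦ 1 + X` (§2.2; the local Galois group `Gal(K_{∞,v}/K_v)`
IS `G_∞`, `v` being totally ramified); proof: "[Kim07] when the sign is `−` … [Kim14] in the `+` case,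
as our ground field is `ℚ_p`". Standing hypotheses (§1.1): `p` ODD; `E/ℚ` of conductor `N` with good
supersingular reduction at `p` and `a_p(E) = 0`; `K` imaginary quadratic with every prime dividing
`pN` split in `K` ((Heeg)); the two primes above `p` totally ramified in `K_∞` (here via `p ∤ h_K`).
TRANSCRIBED (special case, flags `localize-nonsplit`, `local-conj-intersection`,
`HLV-formal-vs-full-points`, `dual-convention`, `local-curve`): in `AcSigned.Setting` (odd `p`, good
supersingular, `a_p = 0`, `K` imaginary quadratic, `p = 𝔭𝔭'` split, `κ` anticyclotomic, `p ∤ h_K`)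
with `N = N_E` and `SatisfiesHeegnerHypothesis N K` (the rest of (Heeg)), for every prime `v` of `K`
above `p`, every proof `hv : IsNonsplitIn κ v` (true in the setting; needed to form `κ_v`), every
topological generator `γ_v ∈ Γ_{K_v}` of `κ_v = localizeAt κ v hv` and every sign `ε`: the dual
`XLoc ((W⁄K).baseChange K_v) p κ_v ε = (ℋ^ε_v)^∨` is free of rank one over `Λ = ℤ_p⟦T⟧`, `T = γ_v − 1`
(`XLoc.IsFreeRankOne`). Printed for ODD `p` — USABLE AT `p = 3`.
[cite: HatleyLeiVigni2022, Prop. 3.2 (a), (3.1), Remark 3.1, §2.2 and §1.1 (standing hypotheses)]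
[cite: BDKim2013, Prop. 2.3 (p. 192)] -/
def hatleyLeiVigni2022_prop32a_localSignedDual_free_rank_one : Prop :=
  ∀ (_ : Setting W K p κ 𝔭 𝔭') (N : ℕ), (W.conductorNorm ℤ : ℕ) = N → SatisfiesHeegnerHypothesis N K →
    ∀ (v : HeightOneSpectrum (𝓞 K)), ((p : ℕ) : 𝓞 K) ∈ v.asIdeal → ∀ (hv : IsNonsplitIn κ v)
    (γv : absoluteGaloisGroup (v.adicCompletion K)) (hγv : (localizeAt κ v hv).IsTopGenerator γv)
    (ε : ℤˣ),
      XLoc.IsFreeRankOne ((W.baseChange K).baseChange (v.adicCompletion K)) p (localizeAt κ v hv) ε hγv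

/-- **Hatley–Lei–Vigni 2022, proof of Lemma 3.8 (from Prop. 3.2 (a)) with Remark 3.1: `ℋ^±_{n,v}[p^m]
≃ ((ℤ/p^m ℤ)[G_n])^∨`, so `#ℋ^±_{n,v}[p^m] = p^{m·p^n}`.** Printed (proof of Lemma 3.8): "Since `E` has
supersingular reduction at `p`, `H⁰(K_{n',v}, A_m) = 0` … The inflation-restriction exact sequence
gives an isomorphism `res : H¹(K_{n,v}, A_m) ≅ H¹(K_{n',v}, A_m)^{𝒢_{n'/n}}` … Proposition 3.2 (a)
tells us that there is an isomorphism of `Λ`-modules `ℋ^±_{n,v}[p^m] ≃ ((ℤ/p^m ℤ)[G_n])^∨`, and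
similarly for `n'`"; Remark 3.1: "the natural maps `H¹(K_n, E[p^∞]) → H¹(K_{∞,v}, E[p^∞])^{𝒢_{∞/n}}`
and `H¹(K_{n,v}, E[p^m]) → H¹(K_{n,v}, E[p^∞])[p^m]` are isomorphisms … we may identify …
`ℋ^±_{n,v}[p^m]` as [a] submodule of `H¹(K_{n,v}, A_m)`" (`G_n = Gal(K_n/K) ≃ ℤ/p^n`, §2.1; `ℋ^±_{n,v} :=
(ℋ^±_v)^{Gal(K_{∞,v}/K_{n,v})}`). Standing hypotheses as in
`hatleyLeiVigni2022_prop32a_localSignedDual_free_rank_one` (odd `p`). TRANSCRIBED (same special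
case and flags) as the CARDINALITY of the finite-level local signed condition: the pullback
`localCondTorsion ((W⁄K).baseChange K_v) p κ_v ε n m ≤ H¹(K_{n,w}, E[p^m])` of `ℋ^ε` along `θ_{n,m}`
— which IS `ℋ^±_{n,v}[p^m]` under Remark 3.1's isomorphism — has exactly `p^{m·p^n}` elements (the
order of `(ℤ/p^m ℤ)[G_n]`), for all `n, m`. A finite, checkable statement; printed for ODD `p` —
USABLE AT `p = 3`. [cite: HatleyLeiVigni2022, proof of Lemma 3.8, Remark 3.1, Prop. 3.2 (a), §2.1] -/
def hatleyLeiVigni2022_lemma38_card_localCondTorsion : Prop :=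
  ∀ (_ : Setting W K p κ 𝔭 𝔭') (N : ℕ), (W.conductorNorm ℤ : ℕ) = N → SatisfiesHeegnerHypothesis N K →
    ∀ (v : HeightOneSpectrum (𝓞 K)), ((p : ℕ) : 𝓞 K) ∈ v.asIdeal → ∀ (hv : IsNonsplitIn κ v)
    (ε : ℤˣ) (n m : ℕ),
      Nat.card (localCondTorsion ((W.baseChange K).baseChange (v.adicCompletion K)) p
        (localizeAt κ v hv) ε n m) = p ^ (m * p ^ n)

/-- **Castella–Wan 2024, §6.1 (with Prop. 3.11 and Def. 4.6): the compact local signed module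
`H¹_±(K_v, 𝐓^ac_{v₁})` is a FREE `ℤ_p⟦Γ^ac_{v₁}⟧`-module of RANK ONE.** Printed (MS p. 25): "for every
prime `v` of `K` above `p` we have `H¹_±(K_v, 𝐓_{v₁}) ≃ H¹_±(ℚ_p, 𝐓_𝔭)`, which is generated as
`ℤ_p⟦Γ_{v₁}⟧`-module by the element `b^±` … we obtain a system `a^± = {a^±_m}_m ∈ lim←_m H¹_±(K^ac_{m,v₁},
T) ≃ H¹_±(K_v, 𝐓^ac_{v₁})` which by Proposition 3.11 generates `H¹_±(K_v, 𝐓^ac_{v₁})` as a free rank one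
`ℤ_p⟦Γ^ac_{v₁}⟧`-module" (`v₁` a prime of `K^ac_∞` above `v`; Def. 4.6 "`H¹_±(K_v, 𝐓^ac_{v₁})` … the
image of `H¹_±(K_v, 𝐓_{v₁}) ≃ H¹_±(ℚ_p, 𝐓_𝔭)` under the map induced by the projection `Γ ↠ Γ^ac`");
proof of Thm. 6.8 (MS p. 30): "Since `H¹_±(K_𝔭, 𝐓^ac) ≃ Λ^ac` (see Proposition 3.8)". Standing
hypotheses of §6 (MS p. 25): `E/ℚ` of conductor `N`, `p > 3` good supersingular, `K` imaginary
quadratic with (gen-H) and (spl). TRANSCRIBED (special case, flags `CW24-local-condition` — the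
carrier is `lim←_{n,m}` of Hatley–Lei–Vigni's `ℋ^±_{n,v}[p^m]` —, `localize-nonsplit`, `local-curve`,
`N⁻ = 1`, `tot-ram-via-h_K`): in `AcSigned.Setting` with `N = N_E`, `SatisfiesHeegnerHypothesis N K`,
`3 < p` VERBATIM, for every prime `v` above `p` (one prime `v₁` of `K^ac_∞` above it, so `Γ^ac_{v₁} =
Γ^ac`), every `hv : IsNonsplitIn κ v`, every topological generator `γ_v` of `κ_v` and every sign:
`localSignedLambdaAdic ((W⁄K).baseChange K_v) p κ_v γ_v ε` is free of rank one over `Λ = ℤ_p⟦T⟧`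
(`localSignedLambdaAdic.IsFreeRankOne`). NOT usable at `p = 3` (printed `p > 3`; its §3 inputs
Lemma 3.9 / Prop. 3.11 are printed for odd `p`).
[cite: CastellaWan2023, §6.1 (MS p. 25), Def. 4.6 (MS p. 21), Prop. 3.11 and Lemma 3.9 (MS p. 15), proof of Thm. 6.8 (MS p. 30)] -/
def castellaWan2024_sec61_localSignedLambdaAdic_free_rank_one : Prop :=
  ∀ (_ : Setting W K p κ 𝔭 𝔭') (N : ℕ), (W.conductorNorm ℤ : ℕ) = N → SatisfiesHeegnerHypothesis N K →
    3 < p → ∀ (v : HeightOneSpectrum (𝓞 K)), ((p : ℕ) : 𝓞 K) ∈ v.asIdeal → ∀ (hv : IsNonsplitIn κ v)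
    (γv : absoluteGaloisGroup (v.adicCompletion K)) (hγv : (localizeAt κ v hv).IsTopGenerator γv)
    (ε : ℤˣ),
      localSignedLambdaAdic.IsFreeRankOne ((W.baseChange K).baseChange (v.adicCompletion K)) p
        (localizeAt κ v hv) γv hγv ε

end Facts

end AcSigned

end Literature.NumberTheory.EllipticCurves

end
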